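import Summits.ValiantsHypothesis.ValiantsHypothesis.Theorems.GrenetZeonDualUnipotentThreeHalvesHeavyTopCompositionBoundFiveSeven

/-!
# `GrenetZeon.DualUnipotentThreeHalves` (stmt-ValiantsHypothesis-24318), R2 `HeavyTopLaw` — instrument kernel row
# «§8 enumerator soundness», LAYER 3e: `HeavyTopInst 5 8` FROM `ι(5) ≤ 8 ∧ ι(6) ≤ 9 ∧ ι(7) ≤ 14 ∧ ι(8) ≤ 19`
# (the `(5,8)` row of INSTANCES.md v2.2a §8: a THREE-level mixed coarsening)

`n = 5`, `m = 8`, `n² = 25`.  With the cut profile `a t = #{i : lvl i < t}` of the `W`-composition chain (✓ layer 2):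
* a cut with `3 ≤ a t ≤ 5` is a COARSENING cut: two levels, Gerstenhaber, `10 + C(a,2) + C(8−a,2) ≤ 23 < 25`;
* otherwise all cuts lie in `{0,1,2} ∪ {6,7,8}`; the fine level `t⋆` straddling `[2,6]` (`a t⋆ ≤ 2`, `a (t⋆+1) ≥ 6`, found by
  `Nat.find`) is ONE IRREDUCIBLE block of size `s = a(t⋆+1) − a t⋆ ∈ [4,8]`; the fine levels below it are MERGED into one
  coarse level of size `a t⋆ ≤ 2` (Gerstenhaber: `≤ C(2,2) = 1`), those above into one of size `8 − a(t⋆+1) ≤ 2`; the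
  coarse flag has `p ≤ 3` levels and costs at most `15 + 1 + β(s) + 1` resp. `10 + β(s) + 1`, `5 + β(8)`: with
  `β(4) = 5 = C(4,2) − 1` (trivial irreducible bound ✓ `finrank_le_choose_two_sub_one_of_irreducible`), `β(5) = 8`, `β(6) = 9`,
  `β(7) = 14`, `β(8) = 19` every case is `≤ 24 < 25` (the nine leaves are listed in the proof).
Tools added here: `finrank_blockSpan_le_choose_two` (Gerstenhaber on a MERGED coarse block — no irreducibility) and
`reindex_toBlock_eq_of_iff` (a coarse level that is a single fine level has the same block space).

* `heavyTopInst_five_eight_of_iota (hι5) (hι6) (hι7) (hι8) : HeavyTopInst 5 8`.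

HONEST LABEL: a CONDITIONAL instance row (the four `ι`-bounds are OPEN finite questions); nothing here proves `HeavyTopInst 5 8`
outright, nor `HeavyTopLaw`, 24318, S3b; `VP ≠ VNP` is NOT proved; no summit statement is proved here.  No definitions, no
named facts.  (Desk RULING #299 (a); instance table val-port-3 g2; critic of record val-idea-crit-3 g4.)  [folklore bookkeeping]
-/

noncomputable section

-- single-conjunct layout: Sub = Summit, duplicated namespace component intended
set_option linter.dupNamespace false

namespace Summit.ValiantsHypothesis.ValiantsHypothesis.Theorems.GrenetZeon.HeavyTopCompositionBound

open MvPolynomial Matrix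
open scoped BigOperators
open Summit.ValiantsHypothesis.ValiantsHypothesis.Cruxes.TwoDimCoefficients.DimTwoCases (AffMat IsAffine)
open Summit.ValiantsHypothesis.ValiantsHypothesis.Theorems.GrenetZeon.RadicalSplit
open Summit.ValiantsHypothesis.ValiantsHypothesis.Theorems.GrenetZeon.HeavyTopInvariantFlag (flagCheap_of_invariant_levels)
open Literature.LinearAlgebra.Matrix.GerstenhaberNilpotentSubspace (finrank_le_choose_two)

variable {m : ℕ}

/-! ## §1 Two more block tools -/

/-- **Gerstenhaber on any (possibly merged) block**: the `t`-th block space of the conjugated tops has dimension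
`≤ C(s, 2)` — no irreducibility needed. [Gerstenhaber 1958 via the tree] -/
theorem finrank_blockSpan_le_choose_two {n : ℕ} (N : AffMat n m) (hN : IsAffine N) (hnil : N ^ m = 0)
    (T : (Fin n × Fin n → ℂ) →ₗ[ℂ] Matrix (Fin m) (Fin m) ℂ) (hT : ∀ v, T v = linPart N v)
    (P : (Matrix (Fin m) (Fin m) ℂ)ˣ) (lvl : Fin m → ℕ)
    (hPW : ∀ A ∈ (ℂ ∙ N.map (MvPolynomial.eval 0)) ⊔ LinearMap.range T, ∀ i j : Fin m, lvl i < lvl j →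
      ((P : Matrix (Fin m) (Fin m) ℂ) * A * (↑P⁻¹ : Matrix (Fin m) (Fin m) ℂ)) i j = 0)
    (t : ℕ) {s : ℕ} (e : {i : Fin m // lvl i = t} ≃ Fin s) :
    Module.finrank ℂ (Submodule.span ℂ (Set.range fun v : Fin n × Fin n → ℂ =>
        Matrix.reindex e e (((P : Matrix (Fin m) (Fin m) ℂ) * linPart N v * (↑P⁻¹ : Matrix (Fin m) (Fin m) ℂ)).toBlock
          (fun i => lvl i = t) (fun i => lvl i = t)))) ≤ s.choose 2 := by
  classical
  let blkW : Matrix (Fin m) (Fin m) ℂ →ₗ[ℂ] Matrix (Fin s) (Fin s) ℂ :=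
    { toFun := fun A => Matrix.reindex e e
        ((((P : Matrix (Fin m) (Fin m) ℂ) * A * (↑P⁻¹ : Matrix (Fin m) (Fin m) ℂ)).toBlock
          (fun i => lvl i = t) (fun i => lvl i = t)))
      map_add' := fun A B => by
        ext a c
        simp only [Matrix.reindex_apply, Matrix.submatrix_apply, Matrix.toBlock_apply, Matrix.add_apply,
          Matrix.mul_add, Matrix.add_mul]
      map_smul' := fun c A => by
        ext a a'
        simp only [Matrix.reindex_apply, Matrix.submatrix_apply, Matrix.toBlock_apply, Matrix.smul_apply,
          Matrix.mul_smul, Matrix.smul_mul, RingHom.id_apply] }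
  have hVnil : ∀ B ∈ ((ℂ ∙ N.map (MvPolynomial.eval 0)) ⊔ LinearMap.range T).map blkW, IsNilpotent B := by
    intro B hB
    obtain ⟨A, hA, rfl⟩ := Submodule.mem_map.1 hB
    exact isNilpotent_block_of_mem N hN hnil T hT P lvl A hA (hPW A hA) t e
  refine (Submodule.finrank_mono ?_).trans (finrank_le_choose_two s _ hVnil)
  rw [Submodule.span_le]
  rintro _ ⟨v, rfl⟩
  refine ⟨linPart N v, ?_, rfl⟩
  rw [SetLike.mem_coe, ← hT]
  exact Submodule.mem_sup_right (LinearMap.mem_range_self T v)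

/-- A coarse level that consists of exactly one fine level has the same re-indexed diagonal blocks. [folklore] -/
theorem reindex_toBlock_eq_of_iff (lvl lvl' : Fin m → ℕ) (t u : ℕ) (h : ∀ i, lvl' i = u ↔ lvl i = t)
    {s : ℕ} (e : {i : Fin m // lvl i = t} ≃ Fin s) (M : Matrix (Fin m) (Fin m) ℂ) :
    Matrix.reindex ((Equiv.subtypeEquivRight h).trans e) ((Equiv.subtypeEquivRight h).trans e)
        (M.toBlock (fun i => lvl' i = u) (fun i => lvl' i = u)) =
      Matrix.reindex e e (M.toBlock (fun i => lvl i = t) (fun i => lvl i = t)) := by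
  ext a c
  simp only [Matrix.reindex_apply, Matrix.submatrix_apply, Matrix.toBlock_apply, Equiv.symm_trans_apply,
    Equiv.subtypeEquivRight_symm_apply_coe]

/-! ## §2 `HeavyTopInst 5 8` from `ι(5) ≤ 8`, `ι(6) ≤ 9`, `ι(7) ≤ 14`, `ι(8) ≤ 19` -/

set_option maxHeartbeats 3200000 in
/-- **`ι(5) ≤ 8 ∧ ι(6) ≤ 9 ∧ ι(7) ≤ 14 ∧ ι(8) ≤ 19 ⟹ HeavyTopInst 5 8`** (INSTANCES.md v2.2a §8, kernel form; the `ι`-bounds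
are HYPOTHESES on irreducible nilpotent subspaces).  Conditional instance row; NOT a proof of `HeavyTopInst 5 8`, `HeavyTopLaw`
or 24318. [folklore bookkeeping over Theorem G] -/
theorem heavyTopInst_five_eight_of_iota
    (hι5 : ∀ V : Submodule ℂ (Matrix (Fin 5) (Fin 5) ℂ), (∀ A ∈ V, IsNilpotent A) →
      (∀ U : Submodule ℂ (Fin 5 → ℂ), (∀ A ∈ V, ∀ x ∈ U, A *ᵥ x ∈ U) → U = ⊥ ∨ U = ⊤) →
      Module.finrank ℂ V ≤ 8)
    (hι6 : ∀ V : Submodule ℂ (Matrix (Fin 6) (Fin 6) ℂ), (∀ A ∈ V, IsNilpotent A) →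
      (∀ U : Submodule ℂ (Fin 6 → ℂ), (∀ A ∈ V, ∀ x ∈ U, A *ᵥ x ∈ U) → U = ⊥ ∨ U = ⊤) →
      Module.finrank ℂ V ≤ 9)
    (hι7 : ∀ V : Submodule ℂ (Matrix (Fin 7) (Fin 7) ℂ), (∀ A ∈ V, IsNilpotent A) →
      (∀ U : Submodule ℂ (Fin 7 → ℂ), (∀ A ∈ V, ∀ x ∈ U, A *ᵥ x ∈ U) → U = ⊥ ∨ U = ⊤) →
      Module.finrank ℂ V ≤ 14)
    (hι8 : ∀ V : Submodule ℂ (Matrix (Fin 8) (Fin 8) ℂ), (∀ A ∈ V, IsNilpotent A) →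
      (∀ U : Submodule ℂ (Fin 8 → ℂ), (∀ A ∈ V, ∀ x ∈ U, A *ᵥ x ∈ U) → U = ⊥ ∨ U = ⊤) →
      Module.finrank ℂ V ≤ 19) :
    HeavyTopInst 5 8 := by
  classical
  intro N hN hnil _
  obtain ⟨T, hT⟩ := exists_topMap_linPart N hN
  obtain ⟨P, L, lvl, hlvl, _hLm, hne, hblk, hirr⟩ :=
    exists_block_conj (((ℂ ∙ N.map (MvPolynomial.eval 0)) ⊔ LinearMap.range T : Submodule ℂ (Matrix (Fin 8) (Fin 8) ℂ)) :
      Set (Matrix (Fin 8) (Fin 8) ℂ))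
  have hPW : ∀ A ∈ (ℂ ∙ N.map (MvPolynomial.eval 0)) ⊔ LinearMap.range T, ∀ i j : Fin 8, lvl i < lvl j →
      ((P : Matrix (Fin 8) (Fin 8) ℂ) * A * (↑P⁻¹ : Matrix (Fin 8) (Fin 8) ℂ)) i j = 0 := fun A hA => hblk A hA
  have hpoly := pencil_blockUpper_of_forall_mem N T hT P lvl hPW
  have hι4 : ∀ V : Submodule ℂ (Matrix (Fin 4) (Fin 4) ℂ), (∀ A ∈ V, IsNilpotent A) →
      (∀ U : Submodule ℂ (Fin 4 → ℂ), (∀ A ∈ V, ∀ x ∈ U, A *ᵥ x ∈ U) → U = ⊥ ∨ U = ⊤) →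
      Module.finrank ℂ V ≤ 5 :=
    fun V hV hirrV => (finrank_le_choose_two_sub_one_of_irreducible (by norm_num) V hV hirrV).trans (by decide)
  have hbound : ∀ (t : ℕ), t < L → ∀ (s : ℕ) (e : {i : Fin 8 // lvl i = t} ≃ Fin s) (β : ℕ),
      (∀ V : Submodule ℂ (Matrix (Fin s) (Fin s) ℂ), (∀ B ∈ V, IsNilpotent B) →
        (∀ U : Submodule ℂ (Fin s → ℂ), (∀ B ∈ V, ∀ x ∈ U, B *ᵥ x ∈ U) → U = ⊥ ∨ U = ⊤) →
        Module.finrank ℂ V ≤ β) →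
      Module.finrank ℂ (Submodule.span ℂ (Set.range fun v : Fin 5 × Fin 5 → ℂ =>
        Matrix.reindex e e (((P : Matrix (Fin 8) (Fin 8) ℂ) * linPart N v * (↑P⁻¹ : Matrix (Fin 8) (Fin 8) ℂ)).toBlock
          (fun i => lvl i = t) (fun i => lvl i = t)))) ≤ β :=
    fun t ht s e β hβ => finrank_blockSpan_le N hN hnil T hT P lvl hPW t e β hβ (hirr t ht s e)
  -- the cut profile
  have hcutL : ∀ t, L ≤ t → (Finset.univ.filter (fun i : Fin 8 => lvl i < t)).card = 8 := cut_eq_card lvl hlvl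
  have hstep : ∀ t, t < L → (Finset.univ.filter (fun i : Fin 8 => lvl i < t)).card <
      (Finset.univ.filter (fun i : Fin 8 => lvl i < t + 1)).card := by
    intro t ht; rw [cut_succ]; have := hne t ht; omega
  by_cases hA : ∃ t, 3 ≤ (Finset.univ.filter (fun i : Fin 8 => lvl i < t)).card ∧
      (Finset.univ.filter (fun i : Fin 8 => lvl i < t)).card ≤ 5
  · -- COARSEN at the cut `t`: two levels, Gerstenhaber
    obtain ⟨t, h3, h5⟩ := hA
    let lvl' : Fin 8 → ℕ := fun i => if lvl i < t then 0 else 1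
    have hlvl' : ∀ i, lvl' i < 2 := fun i => by dsimp only [lvl']; split_ifs <;> norm_num
    have hblock' : ∀ i j : Fin 8, lvl' i < lvl' j →
        ((P : Matrix (Fin 8) (Fin 8) ℂ).map C * N * (↑P⁻¹ : Matrix (Fin 8) (Fin 8) ℂ).map C :
          Matrix (Fin 8) (Fin 8) (MvPolynomial (Fin 5 × Fin 5) ℂ)) i j = 0 := by
      intro i j hij
      apply hpoly i j
      dsimp only [lvl'] at hij
      split_ifs at hij with hi hj <;> omega
    have hc0 : Fintype.card {i : Fin 8 // lvl' i = 0} = (Finset.univ.filter (fun i : Fin 8 => lvl i < t)).card := by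
      rw [Fintype.card_subtype]; congr 1; ext i; simp [lvl']
    have hc1 : Fintype.card {i : Fin 8 // lvl' i = 1} = 8 - (Finset.univ.filter (fun i : Fin 8 => lvl i < t)).card := by
      rw [Fintype.card_subtype]
      have h := Finset.card_filter_add_card_filter_not (s := (Finset.univ : Finset (Fin 8))) (fun i => lvl i < t)
      rw [Finset.card_univ, Fintype.card_fin] at h
      have h' : (Finset.univ.filter (fun i : Fin 8 => lvl' i = 1)) = Finset.univ.filter (fun i => ¬ lvl i < t) := by
        ext i; simp [lvl']
      rw [h']; omega
    refine flagCheap_of_invariant_levels N hN hnil P lvl' 2 (by norm_num) hlvl' hblock' ?_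
    rw [Finset.sum_range_succ, Finset.sum_range_succ, Finset.sum_range_zero, zero_add, hc0, hc1]
    set x := (Finset.univ.filter (fun i : Fin 8 => lvl i < t)).card with hx
    interval_cases x <;> decide
  · -- every cut is `≤ 2` or `≥ 6`
    obtain ⟨a, ha⟩ : ∃ a : ℕ → ℕ, ∀ t, a t = (Finset.univ.filter (fun i : Fin 8 => lvl i < t)).card :=
      ⟨_, fun _ => rfl⟩
    have ha0 : a 0 = 0 := by rw [ha]; simp
    have haL : ∀ t, L ≤ t → a t = 8 := fun t ht => by rw [ha]; exact hcutL t ht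
    have hamono : ∀ t t', t ≤ t' → a t ≤ a t' := by
      intro t t' htt'
      rw [ha, ha]
      exact Finset.card_le_card (fun i => by simp only [Finset.mem_filter, Finset.mem_univ, true_and]; omega)
    have hst : ∀ t, t < L → a t < a (t + 1) := fun t ht => by rw [ha, ha]; exact hstep t ht
    have hB : ∀ t, a t ≤ 2 ∨ 6 ≤ a t := by
      intro t
      by_contra h
      push Not at h
      exact hA ⟨t, by rw [← ha]; omega, by rw [← ha]; omega⟩
    -- the straddling level `t⋆`
    have hex : ∃ t, 6 ≤ a (t + 1) := ⟨L, by rw [haL (L + 1) (by omega)]; omega⟩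
    obtain ⟨ts, h6, hmin⟩ : ∃ ts, 6 ≤ a (ts + 1) ∧ ∀ t, t < ts → ¬ 6 ≤ a (t + 1) :=
      ⟨Nat.find hex, Nat.find_spec hex, fun t ht => Nat.find_min hex ht⟩
    have hlo : a ts ≤ 2 := by
      rcases Nat.eq_zero_or_pos ts with h0 | hpos
      · rw [h0, ha0]; omega
      · have h := hmin (ts - 1) (by omega)
        rw [Nat.sub_add_cancel hpos] at h
        rcases hB ts with h' | h' <;> omega
    have htsL : ts < L := by
      by_contra h
      have := haL ts (by omega)
      omega
    have hhi8 : a (ts + 1) ≤ 8 := by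
      rw [ha]
      calc _ ≤ (Finset.univ : Finset (Fin 8)).card := Finset.card_filter_le _ _
        _ = 8 := by simp
    -- the three groups of coordinates: below, at, above `t⋆`
    have hcard_lo : (Finset.univ.filter (fun i : Fin 8 => lvl i < ts)).card = a ts := (ha ts).symm
    have hcard_mid : (Finset.univ.filter (fun i : Fin 8 => lvl i = ts)).card = a (ts + 1) - a ts := by
      rw [ha, ha, cut_succ]; omega
    have hcard_hi : (Finset.univ.filter (fun i : Fin 8 => ts < lvl i)).card = 8 - a (ts + 1) := by
      have h := Finset.card_filter_add_card_filter_not (s := (Finset.univ : Finset (Fin 8))) (fun i => lvl i < ts + 1)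
      rw [Finset.card_univ, Fintype.card_fin, ← ha] at h
      have h' : (Finset.univ.filter (fun i : Fin 8 => ts < lvl i)) = Finset.univ.filter (fun i => ¬ lvl i < ts + 1) := by
        ext i; simp only [Finset.mem_filter, Finset.mem_univ, true_and]; omega
      rw [h']; omega
    -- block-upper transfer to any level function monotone in `lvl`
    have hpolyMono : ∀ (lvl' : Fin 8 → ℕ), (∀ i j, lvl' i < lvl' j → lvl i < lvl j) → ∀ i j : Fin 8, lvl' i < lvl' j →
        ((P : Matrix (Fin 8) (Fin 8) ℂ).map C * N * (↑P⁻¹ : Matrix (Fin 8) (Fin 8) ℂ).map C :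
          Matrix (Fin 8) (Fin 8) (MvPolynomial (Fin 5 × Fin 5) ℂ)) i j = 0 :=
      fun lvl' hmono i j hij => hpoly i j (hmono i j hij)
    have hPWMono : ∀ (lvl' : Fin 8 → ℕ), (∀ i j, lvl' i < lvl' j → lvl i < lvl j) →
        ∀ A ∈ (ℂ ∙ N.map (MvPolynomial.eval 0)) ⊔ LinearMap.range T, ∀ i j : Fin 8, lvl' i < lvl' j →
          ((P : Matrix (Fin 8) (Fin 8) ℂ) * A * (↑P⁻¹ : Matrix (Fin 8) (Fin 8) ℂ)) i j = 0 :=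
      fun lvl' hmono A hA i j hij => hPW A hA i j (hmono i j hij)
    -- the irreducible middle block, transported to a coarse level `u` that is exactly the fine level `t⋆`
    have hmid : ∀ (lvl' : Fin 8 → ℕ) (u : ℕ) (hiff : ∀ i, lvl' i = u ↔ lvl i = ts) (s : ℕ)
        (e : {i : Fin 8 // lvl i = ts} ≃ Fin s) (β : ℕ),
        (∀ V : Submodule ℂ (Matrix (Fin s) (Fin s) ℂ), (∀ B ∈ V, IsNilpotent B) →
          (∀ U : Submodule ℂ (Fin s → ℂ), (∀ B ∈ V, ∀ x ∈ U, B *ᵥ x ∈ U) → U = ⊥ ∨ U = ⊤) →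
          Module.finrank ℂ V ≤ β) →
        ∃ (s' : ℕ) (e' : {i : Fin 8 // lvl' i = u} ≃ Fin s'),
          Module.finrank ℂ (Submodule.span ℂ (Set.range fun v : Fin 5 × Fin 5 → ℂ =>
            Matrix.reindex e' e' (((P : Matrix (Fin 8) (Fin 8) ℂ) * linPart N v * (↑P⁻¹ : Matrix (Fin 8) (Fin 8) ℂ)).toBlock
              (fun i => lvl' i = u) (fun i => lvl' i = u)))) ≤ β := by
      intro lvl' u hiff s e β hβ
      refine ⟨s, (Equiv.subtypeEquivRight hiff).trans e, ?_⟩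
      have hfun : (fun v : Fin 5 × Fin 5 → ℂ =>
            Matrix.reindex ((Equiv.subtypeEquivRight hiff).trans e) ((Equiv.subtypeEquivRight hiff).trans e)
              (((P : Matrix (Fin 8) (Fin 8) ℂ) * linPart N v * (↑P⁻¹ : Matrix (Fin 8) (Fin 8) ℂ)).toBlock
                (fun i => lvl' i = u) (fun i => lvl' i = u))) =
          (fun v : Fin 5 × Fin 5 → ℂ =>
            Matrix.reindex e e (((P : Matrix (Fin 8) (Fin 8) ℂ) * linPart N v * (↑P⁻¹ : Matrix (Fin 8) (Fin 8) ℂ)).toBlock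
              (fun i => lvl i = ts) (fun i => lvl i = ts))) :=
        funext fun v => reindex_toBlock_eq_of_iff lvl lvl' ts u hiff e _
      rw [hfun]
      exact hbound ts htsL s e β hβ
    -- Gerstenhaber on a merged coarse level of size `r`
    have hger : ∀ (lvl' : Fin 8 → ℕ), (∀ i j, lvl' i < lvl' j → lvl i < lvl j) → ∀ (u r : ℕ),
        (Finset.univ.filter (fun i : Fin 8 => lvl' i = u)).card = r →
        ∃ (s' : ℕ) (e' : {i : Fin 8 // lvl' i = u} ≃ Fin s'),
          Module.finrank ℂ (Submodule.span ℂ (Set.range fun v : Fin 5 × Fin 5 → ℂ =>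
            Matrix.reindex e' e' (((P : Matrix (Fin 8) (Fin 8) ℂ) * linPart N v * (↑P⁻¹ : Matrix (Fin 8) (Fin 8) ℂ)).toBlock
              (fun i => lvl' i = u) (fun i => lvl' i = u)))) ≤ r.choose 2 := by
      intro lvl' hmono u r hr
      obtain ⟨e'⟩ := exists_level_equiv lvl' u r hr
      exact ⟨r, e', finrank_blockSpan_le_choose_two N hN hnil T hT P lvl' (hPWMono lvl' hmono) u e'⟩
    -- the middle block's size and bound, by cases on `(a t⋆, a (t⋆+1))`
    have hlo' := hlo
    have h6' := h6
    by_cases hlo0 : a ts = 0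
    · -- nothing below `t⋆`
      have hbelow : ∀ i : Fin 8, ts ≤ lvl i := by
        intro i
        by_contra h
        have hmem : i ∈ Finset.univ.filter (fun i : Fin 8 => lvl i < ts) := by simp; omega
        have hempty : Finset.univ.filter (fun i : Fin 8 => lvl i < ts) = ∅ :=
          Finset.card_eq_zero.1 (by rw [hcard_lo, hlo0])
        rw [hempty] at hmem
        simp at hmem
      by_cases hhi : a (ts + 1) = 8
      · -- shape `(8)`: one coarse level
        have hall : ∀ i : Fin 8, lvl i = ts := by
          intro i
          have h1 := hbelow i
          by_contra h
          have hmem : i ∈ Finset.univ.filter (fun i : Fin 8 => ts < lvl i) := by simp; omega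
          have hempty : Finset.univ.filter (fun i : Fin 8 => ts < lvl i) = ∅ :=
            Finset.card_eq_zero.1 (by rw [hcard_hi, hhi])
          rw [hempty] at hmem
          simp at hmem
        have hs : (Finset.univ.filter (fun i : Fin 8 => lvl i = ts)).card = 8 := by rw [hcard_mid, hhi, hlo0]
        obtain ⟨e⟩ := exists_level_equiv lvl ts 8 hs
        refine flagCheap_of_block_dims N hN P (fun _ => 0) 1 le_rfl (fun _ => Nat.zero_lt_one)
          (hpolyMono _ fun i j h => absurd h (lt_irrefl _)) (fun _ => 19) (fun u => ?_) (by decide)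
        fin_cases u
        exact hmid (fun _ => 0) 0 (fun i => by simp [hall i]) 8 e 19 hι8
      · -- shape `(s, 8 − s)` with the top group merged: two coarse levels
        let lvl' : Fin 8 → ℕ := fun i => if lvl i ≤ ts then 0 else 1
        have hmono : ∀ i j, lvl' i < lvl' j → lvl i < lvl j := by
          intro i j h; dsimp only [lvl'] at h; split_ifs at h <;> omega
        have hiff : ∀ i, lvl' i = 0 ↔ lvl i = ts := by
          intro i; have := hbelow i; constructor <;> intro h <;> dsimp only [lvl'] at * <;> split_ifs at * <;> omega
        have hc1 : (Finset.univ.filter (fun i : Fin 8 => lvl' i = 1)).card = 8 - a (ts + 1) := by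
          rw [← hcard_hi]; congr 1; ext i; simp only [Finset.mem_filter, Finset.mem_univ, true_and]
          constructor <;> intro h <;> dsimp only [lvl'] at * <;> split_ifs at * <;> omega
        have hlvl' : ∀ i, lvl' i < 2 := fun i => by dsimp only [lvl']; split_ifs <;> norm_num
        -- `a (t⋆+1) ∈ {6, 7}`
        have hs : (Finset.univ.filter (fun i : Fin 8 => lvl i = ts)).card = a (ts + 1) := by rw [hcard_mid, hlo0]; omega
        rcases (show a (ts + 1) = 6 ∨ a (ts + 1) = 7 by omega) with h | h
        · obtain ⟨e⟩ := exists_level_equiv lvl ts 6 (by rw [hs, h])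
          refine flagCheap_of_block_dims N hN P lvl' 2 (by norm_num) hlvl' (hpolyMono lvl' hmono)
            (fun u => if u = 0 then 9 else 1) (fun u => ?_) (by decide)
          fin_cases u
          · exact hmid lvl' 0 hiff 6 e 9 hι6
          · exact hger lvl' hmono 1 2 (by rw [hc1, h])
        · obtain ⟨e⟩ := exists_level_equiv lvl ts 7 (by rw [hs, h])
          refine flagCheap_of_block_dims N hN P lvl' 2 (by norm_num) hlvl' (hpolyMono lvl' hmono)
            (fun u => if u = 0 then 14 else 0) (fun u => ?_) (by decide)
          fin_cases u
          · exact hmid lvl' 0 hiff 7 e 14 hι7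
          · exact hger lvl' hmono 1 1 (by rw [hc1, h])
    · -- something below `t⋆`: `a t⋆ ∈ {1, 2}`
      by_cases hhi : a (ts + 1) = 8
      · -- shape `(a t⋆ merged, s)`: two coarse levels
        have habove : ∀ i : Fin 8, lvl i ≤ ts := by
          intro i
          by_contra h
          have hmem : i ∈ Finset.univ.filter (fun i : Fin 8 => ts < lvl i) := by simp; omega
          have hempty : Finset.univ.filter (fun i : Fin 8 => ts < lvl i) = ∅ :=
            Finset.card_eq_zero.1 (by rw [hcard_hi, hhi])
          rw [hempty] at hmem
          simp at hmem
        let lvl' : Fin 8 → ℕ := fun i => if lvl i < ts then 0 else 1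
        have hmono : ∀ i j, lvl' i < lvl' j → lvl i < lvl j := by
          intro i j h; dsimp only [lvl'] at h; split_ifs at h <;> omega
        have hiff : ∀ i, lvl' i = 1 ↔ lvl i = ts := by
          intro i; have := habove i; constructor <;> intro h <;> dsimp only [lvl'] at * <;> split_ifs at * <;> omega
        have hc0 : (Finset.univ.filter (fun i : Fin 8 => lvl' i = 0)).card = a ts := by
          rw [← hcard_lo]; congr 1; ext i; simp only [Finset.mem_filter, Finset.mem_univ, true_and]
          constructor <;> intro h <;> dsimp only [lvl'] at * <;> split_ifs at * <;> omega
        have hlvl' : ∀ i, lvl' i < 2 := fun i => by dsimp only [lvl']; split_ifs <;> norm_num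
        have hs : (Finset.univ.filter (fun i : Fin 8 => lvl i = ts)).card = 8 - a ts := by rw [hcard_mid, hhi]
        rcases (show a ts = 1 ∨ a ts = 2 by omega) with h | h
        · obtain ⟨e⟩ := exists_level_equiv lvl ts 7 (by rw [hs, h])
          refine flagCheap_of_block_dims N hN P lvl' 2 (by norm_num) hlvl' (hpolyMono lvl' hmono)
            (fun u => if u = 0 then 0 else 14) (fun u => ?_) (by decide)
          fin_cases u
          · exact hger lvl' hmono 0 1 (by rw [hc0, h])
          · exact hmid lvl' 1 hiff 7 e 14 hι7
        · obtain ⟨e⟩ := exists_level_equiv lvl ts 6 (by rw [hs, h])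
          refine flagCheap_of_block_dims N hN P lvl' 2 (by norm_num) hlvl' (hpolyMono lvl' hmono)
            (fun u => if u = 0 then 1 else 9) (fun u => ?_) (by decide)
          fin_cases u
          · exact hger lvl' hmono 0 2 (by rw [hc0, h])
          · exact hmid lvl' 1 hiff 6 e 9 hι6
      · -- three coarse levels: merged below, the irreducible middle block, merged above
        let lvl' : Fin 8 → ℕ := fun i => if lvl i < ts then 0 else if lvl i = ts then 1 else 2
        have hmono : ∀ i j, lvl' i < lvl' j → lvl i < lvl j := by
          intro i j h; dsimp only [lvl'] at h; split_ifs at h <;> omega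
        have hiff : ∀ i, lvl' i = 1 ↔ lvl i = ts := by
          intro i; constructor <;> intro h <;> dsimp only [lvl'] at * <;> split_ifs at * <;> omega
        have hc0 : (Finset.univ.filter (fun i : Fin 8 => lvl' i = 0)).card = a ts := by
          rw [← hcard_lo]; congr 1; ext i; simp only [Finset.mem_filter, Finset.mem_univ, true_and]
          constructor <;> intro h <;> dsimp only [lvl'] at * <;> split_ifs at * <;> omega
        have hc2 : (Finset.univ.filter (fun i : Fin 8 => lvl' i = 2)).card = 8 - a (ts + 1) := by
          rw [← hcard_hi]; congr 1; ext i; simp only [Finset.mem_filter, Finset.mem_univ, true_and]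
          constructor <;> intro h <;> dsimp only [lvl'] at * <;> split_ifs at * <;> omega
        have hlvl' : ∀ i, lvl' i < 3 := fun i => by dsimp only [lvl']; split_ifs <;> norm_num
        have hs : (Finset.univ.filter (fun i : Fin 8 => lvl i = ts)).card = a (ts + 1) - a ts := hcard_mid
        -- `(a t⋆, a (t⋆+1)) ∈ {1,2} × {6,7}`
        rcases (show (a ts = 1 ∧ a (ts + 1) = 6) ∨ (a ts = 1 ∧ a (ts + 1) = 7) ∨ (a ts = 2 ∧ a (ts + 1) = 6) ∨
            (a ts = 2 ∧ a (ts + 1) = 7) by omega) with ⟨h1, h2⟩ | ⟨h1, h2⟩ | ⟨h1, h2⟩ | ⟨h1, h2⟩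
        · obtain ⟨e⟩ := exists_level_equiv lvl ts 5 (by rw [hs, h1, h2])
          refine flagCheap_of_block_dims N hN P lvl' 3 (by norm_num) hlvl' (hpolyMono lvl' hmono)
            (fun u => if u = 0 then 0 else if u = 1 then 8 else 1) (fun u => ?_) (by decide)
          fin_cases u
          · exact hger lvl' hmono 0 1 (by rw [hc0, h1])
          · exact hmid lvl' 1 hiff 5 e 8 hι5
          · exact hger lvl' hmono 2 2 (by rw [hc2, h2])
        · obtain ⟨e⟩ := exists_level_equiv lvl ts 6 (by rw [hs, h1, h2])
          refine flagCheap_of_block_dims N hN P lvl' 3 (by norm_num) hlvl' (hpolyMono lvl' hmono)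
            (fun u => if u = 0 then 0 else if u = 1 then 9 else 0) (fun u => ?_) (by decide)
          fin_cases u
          · exact hger lvl' hmono 0 1 (by rw [hc0, h1])
          · exact hmid lvl' 1 hiff 6 e 9 hι6
          · exact hger lvl' hmono 2 1 (by rw [hc2, h2])
        · obtain ⟨e⟩ := exists_level_equiv lvl ts 4 (by rw [hs, h1, h2])
          refine flagCheap_of_block_dims N hN P lvl' 3 (by norm_num) hlvl' (hpolyMono lvl' hmono)
            (fun u => if u = 0 then 1 else if u = 1 then 5 else 1) (fun u => ?_) (by decide)
          fin_cases u
          · exact hger lvl' hmono 0 2 (by rw [hc0, h1])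
          · exact hmid lvl' 1 hiff 4 e 5 hι4
          · exact hger lvl' hmono 2 2 (by rw [hc2, h2])
        · obtain ⟨e⟩ := exists_level_equiv lvl ts 5 (by rw [hs, h1, h2])
          refine flagCheap_of_block_dims N hN P lvl' 3 (by norm_num) hlvl' (hpolyMono lvl' hmono)
            (fun u => if u = 0 then 1 else if u = 1 then 8 else 0) (fun u => ?_) (by decide)
          fin_cases u
          · exact hger lvl' hmono 0 2 (by rw [hc0, h1])
          · exact hmid lvl' 1 hiff 5 e 8 hι5
          · exact hger lvl' hmono 2 1 (by rw [hc2, h2])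

end Summit.ValiantsHypothesis.ValiantsHypothesis.Theorems.GrenetZeon.HeavyTopCompositionBound

end
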